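import Summits.ValiantsHypothesis.ValiantsHypothesis.Theorems.RigidityForcesSymmetryGrenetFirstOrderRankRigidSweepEval
import Summits.ValiantsHypothesis.ValiantsHypothesis.Theorems.RigidityForcesSymmetryGrenetFirstOrderRankRigidGapDesign

/-!
# Route RigidityForcesSymmetry — `GrenetFirstOrderRankRigid` (item stmt-ValiantsHypothesis-21029),
line `grenet_gauge`: stub `stub_linearRigid`, step 5 (block I>, part 2) — overlap blocks: column
shapes and the point-evaluation frame

For the crux line `Cruxes/GrenetFirstOrderRankRigid/Lines/grenet_gauge.lean` (blueprint
`Lines/grenet_gauge-stub_linearRigid-PROOF.md`, §5, type I>; interface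
`Lines/grenet_gauge-stub_linearRigid-BLOCKS.md`, deliverable (D-PQ)).

A tail entry `(S, T, (p, |S|))` of a homogeneous tangent direction at Grenet's pencil (arc
`S → U := S + p`) and a head entry `(U, T + p', (p', |T|))` lie in the same torus-weight block; the
block has an OVERLAP when `|T| ≤ |S|` (then every monomial of the block has two cells in each overlap
column `|T| ≤ c ≤ |S|`; types I> and II of the blueprint).  This file holds the design-independent
frame of the argument:

* `overlap_column_shape` — in an overlap block the column weights together with the rank constraint
  (tail: `q = s`, head: `t = q + 1`) leave only the TAIL-LIKE shape `(|S|, |T|, |S|)` and the HEAD-LIKE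
  shape `(|S| + 1, |T| + 1, |T|)` for `(|row vertex|, |column vertex|, level of the variable)`;
* `grenet_overlap_PQ_of_pointEval` — if at some point `D` every term of the block with the row and
  column weights of the block evaluates to `-(entry) · [it is one of the two entries]`, then
  `A'(head entry) = - A'(tail entry)` (the weight block of `grenet_tangency_weightSplit`, evaluated).

The overlap designs of `…OverlapTermFwd` / `…OverlapTermBwd` supply such points.  No new definitions.
VP ≠ VNP is not moved by this file (first-order bookkeeping about one matrix family).
-/

noncomputable section

open MvPolynomial Matrix Finset

namespace Summit.ValiantsHypothesis.Theorems.RigidityForcesSymmetry.GrenetGauge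

open Literature.Computability.AlgebraicComplexity

/-! ### Column bookkeeping for overlap blocks -/

section ColumnShape

/-- **Column weights in an overlap block.**  If the column weight
`[c < s] + [t ≤ c] + [c = q]` of an entry equals `[c < s₀] + [t₀ ≤ c] + [c = s₀]` with `t₀ ≤ s₀`
(an overlap `[t₀, s₀]`), `s₀ + 1 < n`, and the entry is a tail (`q = s`) or a head (`t = q + 1`), then
`(s, t, q) = (s₀, t₀, s₀)` (TAIL-LIKE) or `(s, t, q) = (s₀ + 1, t₀ + 1, t₀)` (HEAD-LIKE). [folklore] -/
theorem overlap_column_shape {n s₀ t₀ s t q : ℕ} (hts : t₀ ≤ s₀) (hs₀ : s₀ + 1 < n) (hq : q < n)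
    (h : ∀ c, c < n → (if c < s then 1 else 0) + (if t ≤ c then 1 else 0) + (if c = q then 1 else 0)
      = (if c < s₀ then 1 else 0) + (if t₀ ≤ c then 1 else 0) + (if c = s₀ then (1 : ℕ) else 0))
    (hth : q = s ∨ t = q + 1) :
    (s = s₀ ∧ t = t₀ ∧ q = s₀) ∨ (s = s₀ + 1 ∧ t = t₀ + 1 ∧ q = t₀) := by
  rcases hth with hqs | htq
  · left
    -- the column `s₀`
    have h1 : t ≤ s₀ ∧ s₀ ≤ q := by
      have hc := h s₀ (by omega)
      rw [if_neg (lt_irrefl _), if_pos hts, if_pos rfl] at hc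
      split_ifs at hc <;> omega
    -- the column `q`
    have h2 : q = s₀ := by
      have hc := h q hq
      rw [if_pos rfl] at hc
      split_ifs at hc <;> omega
    -- the column `t₀`
    have h3 : t ≤ t₀ := by
      have hc := h t₀ (by omega)
      rw [if_pos (le_refl _)] at hc
      split_ifs at hc <;> omega
    have h4 : t = t₀ := by
      by_contra hne
      have hc := h t (by omega)
      rw [if_pos (le_refl _)] at hc
      split_ifs at hc <;> omega
    exact ⟨by omega, h4, h2⟩
  · right
    -- the column `s₀`
    have h1 : s₀ < s ∧ q ≤ s₀ := by
      have hc := h s₀ (by omega)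
      rw [if_neg (lt_irrefl _), if_pos hts, if_pos rfl] at hc
      split_ifs at hc <;> omega
    -- the column `s₀ + 1`
    have h2 : s = s₀ + 1 := by
      have hc := h (s₀ + 1) hs₀
      rw [if_neg (by omega : ¬ s₀ + 1 < s₀), if_pos (by omega : t₀ ≤ s₀ + 1),
        if_neg (by omega : ¬ s₀ + 1 = s₀)] at hc
      split_ifs at hc <;> omega
    -- the column `t₀`
    have h3 : q ≤ t₀ := by
      have hc := h t₀ (by omega)
      rw [if_pos (le_refl _)] at hc
      split_ifs at hc <;> omega
    -- the column `q`
    have h4 : q = t₀ := by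
      have hc := h q hq
      rw [if_pos rfl] at hc
      split_ifs at hc <;> omega
    exact ⟨h2, by omega, h4⟩

/-- The complement of a `t₁`-set avoided by a map injective on the levels `≥ t₁` is the image of
these levels. [folklore] -/
theorem compl_eq_image_of_avoid {n : ℕ} (d : Fin n → Fin n) (X : Finset (Fin n))
    (hinj : ∀ c c' : Fin n, X.card ≤ (c : ℕ) → X.card ≤ (c' : ℕ) → d c = d c' → c = c')
    (havoid : ∀ c : Fin n, X.card ≤ (c : ℕ) → d c ∉ X) :
    Xᶜ = (univ.filter fun c : Fin n => X.card ≤ (c : ℕ)).image d := by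
  symm
  apply Finset.eq_of_subset_of_card_le
  · intro x hx
    obtain ⟨c, hc, rfl⟩ := Finset.mem_image.mp hx
    exact Finset.mem_compl.mpr (havoid c (Finset.mem_filter.mp hc).2)
  · rw [Finset.card_compl, Fintype.card_fin, Finset.card_image_of_injOn fun c hc c' hc' hcc =>
        hinj c c' (Finset.mem_filter.mp (Finset.mem_coe.mp hc)).2
          (Finset.mem_filter.mp (Finset.mem_coe.mp hc')).2 hcc,
      card_filter_card_le]

/-- Indicator of membership in `insert a S`, `a ∉ S`, as naturals. [folklore] -/
theorem ite_mem_insert_eq {α : Type*} [DecidableEq α] (S : Finset α) {a : α} (ha : a ∉ S) (x : α) :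
    (if x ∈ insert a S then (1 : ℕ) else 0) = (if x ∈ S then 1 else 0) + (if x = a then 1 else 0) := by
  by_cases h1 : x = a
  · subst h1
    simp [ha]
  · simp [Finset.mem_insert, h1]

end ColumnShape

/-! ### From a point evaluation to the core identity -/

section OverlapPoint

variable {k : Type*} [CommRing k] [IsDomain k] {n N : ℕ} (e : Finset (Fin n) ≃ Fin (N + 1))

/-- **Point-evaluation frame for overlap blocks** (deliverable (D-PQ)).  Let `(i, j, v)` be a TAIL entry
(`v = (p, |S|)`, `p ∉ S = R i`, arc `S → U := S + p`) and `(i', j', v')` a HEAD entry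
(`v' = (p', |T|)`, `T = C j = C j' - p'`) of a homogeneous tangent direction at Grenet's pencil, of the
same pair (`R i' = U`), with `|T| ≤ |S|`.  If at a point `D` every term of the tangency identity carrying
the row weights and the column weights of this block evaluates to `-(its entry) · [it is one of the two
entries]`, then `A'_{v'} i' j' = - A'_v i j` (evaluate the weight block of the tail entry,
`grenet_tangency_weightSplit`, at `D`). [cite: Grenet2011, Thm. 1] -/
theorem grenet_overlap_PQ_of_pointEval (hn : n ≠ 0) (hN : 2 ^ n = N + 1)
    (A' : Fin n × Fin n → Matrix (Fin N) (Fin N) k)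
    (htr : ((Grenet.repr k n e).adjugate * ∑ v, (X v : MvPolynomial (Fin n × Fin n) k) • (A' v).map C).trace = 0)
    {i j : Fin N} {v : Fin n × Fin n} {i' j' : Fin N} {v' : Fin n × Fin n}
    (htail : v.1 ∉ e.symm ((e univ).succAbove i) ∧ (v.2 : ℕ) = (e.symm ((e univ).succAbove i)).card)
    (hhead : v'.1 ∈ e.symm ((e ∅).succAbove j') ∧ (e.symm ((e ∅).succAbove j')).card = (v'.2 : ℕ) + 1)
    (hU : insert v.1 (e.symm ((e univ).succAbove i)) = e.symm ((e univ).succAbove i'))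
    (hT : e.symm ((e ∅).succAbove j) = (e.symm ((e ∅).succAbove j')).erase v'.1)
    (hle : (e.symm ((e ∅).succAbove j)).card ≤ (e.symm ((e univ).succAbove i)).card)
    (D : Fin n × Fin n → k)
    (hD : ∀ (i'' j'' : Fin N) (v'' : Fin n × Fin n),
      (∀ j₁ : Fin n, (if j₁ ∈ e.symm ((e univ).succAbove i'') then 1 else 0)
          + (if j₁ ∈ e.symm ((e ∅).succAbove j'') then 0 else 1) + (if j₁ = v''.1 then 1 else 0)
        = (if j₁ ∈ e.symm ((e univ).succAbove i) then 1 else 0)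
          + (if j₁ ∈ e.symm ((e ∅).succAbove j) then 0 else 1) + (if j₁ = v.1 then (1 : ℕ) else 0)) →
      (∀ c, c < n → (if c < (e.symm ((e univ).succAbove i'')).card then 1 else 0)
          + (if (e.symm ((e ∅).succAbove j'')).card ≤ c then 1 else 0) + (if c = (v''.2 : ℕ) then 1 else 0)
        = (if c < (e.symm ((e univ).succAbove i)).card then 1 else 0)
          + (if (e.symm ((e ∅).succAbove j)).card ≤ c then 1 else 0)
          + (if c = (e.symm ((e univ).succAbove i)).card then (1 : ℕ) else 0)) →
      eval D (C (A' v'' i'' j'') *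
          (perPoly (Fin n) k * (1 - Grenet.adj k n).adjugate (e.symm ((e ∅).succAbove j''))
              (e.symm ((e univ).succAbove i'')) * X v''
            - (1 - Grenet.adj k n).adjugate ∅ (e.symm ((e univ).succAbove i'')) * X v''
              * (1 - Grenet.adj k n).adjugate (e.symm ((e ∅).succAbove j'')) univ))
        = -(A' v'' i'' j'' * if ((i'', j'', v'') = (i, j, v) ∨ (i'', j'', v'') = (i', j', v')) then 1 else 0)) :
    A' v' i' j' = -A' v i j := by
  classical
  -- notation and bookkeeping
  set S := e.symm ((e univ).succAbove i) with hSdef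
  set T := e.symm ((e ∅).succAbove j) with hTdef
  set U := e.symm ((e univ).succAbove i') with hUdef
  set T' := e.symm ((e ∅).succAbove j') with hT'def
  obtain ⟨hpS, hq⟩ := htail
  obtain ⟨hp'T', hq'⟩ := hhead
  have hp'T : v'.1 ∉ T := by rw [hT]; exact Finset.notMem_erase _ _
  have hT'eq : T' = insert v'.1 T := by rw [hT, Finset.insert_erase hp'T']
  have hUcard : U.card = S.card + 1 := by rw [← hU, Finset.card_insert_of_notMem hpS]
  have hTcard : T.card = (v'.2 : ℕ) := by
    have h1 := Finset.card_erase_of_mem hp'T'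
    rw [← hT] at h1
    omega
  -- the weight block of the tail entry, evaluated at the point
  have hblock := grenet_tangency_weightSplit e (fun j => (Pi.single (Sum.inl j) 1 : Fin n ⊕ Fin n → ℕ))
    (fun c => (Pi.single (Sum.inr c) 1 : Fin n ⊕ Fin n → ℕ)) hn hN A' htr
    ((∑ j₁ ∈ S, (Pi.single (Sum.inl j₁) 1 : Fin n ⊕ Fin n → ℕ)
        + ∑ j₁ ∈ Tᶜ, (Pi.single (Sum.inl j₁) 1 : Fin n ⊕ Fin n → ℕ)) +
      (∑ c ∈ univ.filter (fun c : Fin n => (c : ℕ) < S.card), (Pi.single (Sum.inr c) 1 : Fin n ⊕ Fin n → ℕ)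
        + ∑ c ∈ univ.filter (fun c : Fin n => T.card ≤ (c : ℕ)), (Pi.single (Sum.inr c) 1 : Fin n ⊕ Fin n → ℕ))
      + ((Pi.single (Sum.inl v.1) 1 : Fin n ⊕ Fin n → ℕ) + (Pi.single (Sum.inr v.2) 1 : Fin n ⊕ Fin n → ℕ)))
  have h := congrArg (eval D) hblock
  rw [map_sum, map_zero] at h
  -- each term of the block: only the tail entry `(i, j, v)` and the head entry `(i', j', v')` survive
  have hterm : ∀ x ∈ (univ : Finset (Fin N × Fin N × (Fin n × Fin n))).filter (fun x =>
      ((∑ j₁ ∈ e.symm ((e univ).succAbove x.1), (Pi.single (Sum.inl j₁) 1 : Fin n ⊕ Fin n → ℕ)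
          + ∑ j₁ ∈ (e.symm ((e ∅).succAbove x.2.1))ᶜ, (Pi.single (Sum.inl j₁) 1 : Fin n ⊕ Fin n → ℕ)) +
        (∑ c ∈ univ.filter (fun c : Fin n => (c : ℕ) < (e.symm ((e univ).succAbove x.1)).card),
            (Pi.single (Sum.inr c) 1 : Fin n ⊕ Fin n → ℕ)
          + ∑ c ∈ univ.filter (fun c : Fin n => (e.symm ((e ∅).succAbove x.2.1)).card ≤ (c : ℕ)),
            (Pi.single (Sum.inr c) 1 : Fin n ⊕ Fin n → ℕ))
        + ((Pi.single (Sum.inl x.2.2.1) 1 : Fin n ⊕ Fin n → ℕ) + (Pi.single (Sum.inr x.2.2.2) 1 : Fin n ⊕ Fin n → ℕ)))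
      = ((∑ j₁ ∈ S, (Pi.single (Sum.inl j₁) 1 : Fin n ⊕ Fin n → ℕ)
          + ∑ j₁ ∈ Tᶜ, (Pi.single (Sum.inl j₁) 1 : Fin n ⊕ Fin n → ℕ)) +
        (∑ c ∈ univ.filter (fun c : Fin n => (c : ℕ) < S.card), (Pi.single (Sum.inr c) 1 : Fin n ⊕ Fin n → ℕ)
          + ∑ c ∈ univ.filter (fun c : Fin n => T.card ≤ (c : ℕ)), (Pi.single (Sum.inr c) 1 : Fin n ⊕ Fin n → ℕ))
        + ((Pi.single (Sum.inl v.1) 1 : Fin n ⊕ Fin n → ℕ) + (Pi.single (Sum.inr v.2) 1 : Fin n ⊕ Fin n → ℕ)))),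
      eval D (C (A' x.2.2 x.1 x.2.1) *
          (perPoly (Fin n) k * (1 - Grenet.adj k n).adjugate (e.symm ((e ∅).succAbove x.2.1))
              (e.symm ((e univ).succAbove x.1)) * X x.2.2
            - (1 - Grenet.adj k n).adjugate ∅ (e.symm ((e univ).succAbove x.1)) * X x.2.2
              * (1 - Grenet.adj k n).adjugate (e.symm ((e ∅).succAbove x.2.1)) univ))
        = -(A' x.2.2 x.1 x.2.1 * if x = (i, j, v) ∨ x = (i', j', v') then 1 else 0) := by
    rintro ⟨i'', j'', v''⟩ hx
    have hw := (Finset.mem_filter.mp hx).2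
    simp only at hw ⊢
    refine hD i'' j'' v'' (fun j₁ => ?_) (fun c hc => ?_)
    · have h1 := congrFun hw (Sum.inl j₁)
      rwa [weightE_apply_inl, weightE_apply_inl] at h1
    · have h1 := congrFun hw (Sum.inr ⟨c, hc⟩)
      rw [weightE_apply_inr, weightE_apply_inr, ite_fin_eq_eq_ite_val_eq, ite_fin_eq_eq_ite_val_eq, hq] at h1
      simpa only [Fin.val_mk] using h1
  rw [Finset.sum_congr rfl hterm, Finset.sum_neg_distrib, neg_eq_zero] at h
  -- the two surviving entries
  have hne : ((i, j, v) : Fin N × Fin N × (Fin n × Fin n)) ≠ (i', j', v') := by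
    intro h1
    have h2 : i = i' := congrArg Prod.fst h1
    have : S.card = U.card := by rw [hSdef, hUdef, h2]
    omega
  have hxt : ((i, j, v) : Fin N × Fin N × (Fin n × Fin n)) ∈ (univ : Finset (Fin N × Fin N × (Fin n × Fin n))).filter (fun x =>
      ((∑ j₁ ∈ e.symm ((e univ).succAbove x.1), (Pi.single (Sum.inl j₁) 1 : Fin n ⊕ Fin n → ℕ)
          + ∑ j₁ ∈ (e.symm ((e ∅).succAbove x.2.1))ᶜ, (Pi.single (Sum.inl j₁) 1 : Fin n ⊕ Fin n → ℕ)) +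
        (∑ c ∈ univ.filter (fun c : Fin n => (c : ℕ) < (e.symm ((e univ).succAbove x.1)).card),
            (Pi.single (Sum.inr c) 1 : Fin n ⊕ Fin n → ℕ)
          + ∑ c ∈ univ.filter (fun c : Fin n => (e.symm ((e ∅).succAbove x.2.1)).card ≤ (c : ℕ)),
            (Pi.single (Sum.inr c) 1 : Fin n ⊕ Fin n → ℕ))
        + ((Pi.single (Sum.inl x.2.2.1) 1 : Fin n ⊕ Fin n → ℕ) + (Pi.single (Sum.inr x.2.2.2) 1 : Fin n ⊕ Fin n → ℕ)))
      = ((∑ j₁ ∈ S, (Pi.single (Sum.inl j₁) 1 : Fin n ⊕ Fin n → ℕ)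
          + ∑ j₁ ∈ Tᶜ, (Pi.single (Sum.inl j₁) 1 : Fin n ⊕ Fin n → ℕ)) +
        (∑ c ∈ univ.filter (fun c : Fin n => (c : ℕ) < S.card), (Pi.single (Sum.inr c) 1 : Fin n ⊕ Fin n → ℕ)
          + ∑ c ∈ univ.filter (fun c : Fin n => T.card ≤ (c : ℕ)), (Pi.single (Sum.inr c) 1 : Fin n ⊕ Fin n → ℕ))
        + ((Pi.single (Sum.inl v.1) 1 : Fin n ⊕ Fin n → ℕ) + (Pi.single (Sum.inr v.2) 1 : Fin n ⊕ Fin n → ℕ)))) :=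
    Finset.mem_filter.mpr ⟨Finset.mem_univ _, rfl⟩
  have hxh : ((i', j', v') : Fin N × Fin N × (Fin n × Fin n)) ∈ (univ : Finset (Fin N × Fin N × (Fin n × Fin n))).filter (fun x =>
      ((∑ j₁ ∈ e.symm ((e univ).succAbove x.1), (Pi.single (Sum.inl j₁) 1 : Fin n ⊕ Fin n → ℕ)
          + ∑ j₁ ∈ (e.symm ((e ∅).succAbove x.2.1))ᶜ, (Pi.single (Sum.inl j₁) 1 : Fin n ⊕ Fin n → ℕ)) +
        (∑ c ∈ univ.filter (fun c : Fin n => (c : ℕ) < (e.symm ((e univ).succAbove x.1)).card),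
            (Pi.single (Sum.inr c) 1 : Fin n ⊕ Fin n → ℕ)
          + ∑ c ∈ univ.filter (fun c : Fin n => (e.symm ((e ∅).succAbove x.2.1)).card ≤ (c : ℕ)),
            (Pi.single (Sum.inr c) 1 : Fin n ⊕ Fin n → ℕ))
        + ((Pi.single (Sum.inl x.2.2.1) 1 : Fin n ⊕ Fin n → ℕ) + (Pi.single (Sum.inr x.2.2.2) 1 : Fin n ⊕ Fin n → ℕ)))
      = ((∑ j₁ ∈ S, (Pi.single (Sum.inl j₁) 1 : Fin n ⊕ Fin n → ℕ)
          + ∑ j₁ ∈ Tᶜ, (Pi.single (Sum.inl j₁) 1 : Fin n ⊕ Fin n → ℕ)) +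
        (∑ c ∈ univ.filter (fun c : Fin n => (c : ℕ) < S.card), (Pi.single (Sum.inr c) 1 : Fin n ⊕ Fin n → ℕ)
          + ∑ c ∈ univ.filter (fun c : Fin n => T.card ≤ (c : ℕ)), (Pi.single (Sum.inr c) 1 : Fin n ⊕ Fin n → ℕ))
        + ((Pi.single (Sum.inl v.1) 1 : Fin n ⊕ Fin n → ℕ) + (Pi.single (Sum.inr v.2) 1 : Fin n ⊕ Fin n → ℕ)))) := by
    refine Finset.mem_filter.mpr ⟨Finset.mem_univ _, ?_⟩
    simp only
    funext x
    cases x with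
    | inl j₁ =>
      rw [weightE_apply_inl, weightE_apply_inl, ← hUdef, ← hT'def, ← hU, hT'eq]
      exact weightPair_inl S T v.1 v'.1 j₁ hpS hp'T
    | inr c =>
      rw [weightE_apply_inr, weightE_apply_inr, ← hUdef, ← hT'def, hUcard, hT'eq, Finset.card_insert_of_notMem hp'T,
        ite_fin_eq_eq_ite_val_eq, ite_fin_eq_eq_ite_val_eq, hq, ← hTcard]
      split_ifs <;> omega
  rw [Finset.sum_eq_add_of_mem _ _ hxt hxh hne (fun x _ hx => by
    rw [if_neg (not_or.mpr hx), mul_zero]), if_pos (Or.inl rfl), if_pos (Or.inr rfl), mul_one, mul_one] at h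
  linear_combination h

end OverlapPoint

end Summit.ValiantsHypothesis.Theorems.RigidityForcesSymmetry.GrenetGauge
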